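import Summits.ValiantsHypothesis.ValiantsHypothesis.Theorems.GrenetZeonDualUnipotentThreeHalvesLongMassBipartiteGraftPrice

/-!
# `GrenetZeon.DualUnipotentThreeHalves` (stmt-ValiantsHypothesis-24318), stub (c) `SlowCore.LongMassSlowLawInv` —
# the pencil-level graft is `IrreducibleInv` BY NAME (the stub's own hypothesis)

leafhand-val-grenetzeon-2 gen28 (29th hand), 2026-09-01; sequel to ✓ `…BipartiteGraft` (p843376: `graft_irreducible` on values) and
✓ `…BipartiteGraftPrice` (p843398: `relCert_graft`).  The stub (c) quantifies over affine pencils `B` with `IsAffine B`, `B^b = 0` and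
✓ `SlowCore.IrreducibleInv B` (no common invariant subspace of the VALUES `B(x)`).  Here: the pencil-level graft
`G = reindex e e [[0, [sp | Tp+Np]], [[Tp ; −sp], 0]]` is `IrreducibleInv` as soon as the pencil is FULL on the `(T, s)`-coordinates off the core
(`∀ T s, ∃ x, Tp(x) = T ∧ Np(x) = 0 ∧ sp(x) = s`) — `irreducibleInv_graft`.  Together with ✓ `isAffine_graft`, ✓ `graft_pencil_pow_eq_zero`,
✓ `relCert_graft` / ✓ `relCert_graft_of_triangularisable` the graft over `𝔫_k` is a by-name member of the stub's domain: affine, `G^b = 0`,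
`IrreducibleInv`, FAT (`k² + C(k,2) + 1` independent directions) and LONG (index `2k−1`), with `RelCert n (3k) G (2⌊√n⌋k + 2n + 1)` — i.e. it
satisfies (c) at constant `c = 2 + o(1)`; the first fat ∧ long ∧ irreducible species on the (c)-menu.

* `smul_one_map_ringHom`, `graft_map_eval` — evaluation commutes with the construction;
* `reindex_mulVec_comp` — `(reindex e e X) *ᵥ (w ∘ e.symm) = (X *ᵥ w) ∘ e.symm`;
* ★ `irreducibleInv_graft`.

Honest framing.  Helper (`--supports stmt-ValiantsHypothesis-24318`); nothing here proves (c), S3, 24318, 8062 or `VP ≠ VNP` — all OPEN / NOT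
proved.  No definitions, no sorry, standard axioms.
-/

set_option linter.dupNamespace false
set_option autoImplicit false

namespace Summit.ValiantsHypothesis.ValiantsHypothesis.Theorems.GrenetZeon.BipartiteGraft

open MvPolynomial Matrix
open scoped BigOperators
open Summit.ValiantsHypothesis.ValiantsHypothesis.Cruxes.TwoDimCoefficients.DimTwoCases (AffMat IsAffine)
open Summit.ValiantsHypothesis.ValiantsHypothesis.Theorems.GrenetZeon.SlowCore (IrreducibleInv)

section RingHomMap

variable {A B : Type*} [CommSemiring A] [CommSemiring B] {ι : Type*} [DecidableEq ι]

/-- A ring map sends `s·1` to `φ(s)·1` entrywise. [folklore] -/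
theorem smul_one_map_ringHom (φ : A →+* B) (s : A) :
    (s • (1 : Matrix ι ι A)).map φ = φ s • (1 : Matrix ι ι B) := by
  ext i j
  rw [Matrix.map_apply, Matrix.smul_apply, Matrix.smul_apply, Matrix.one_apply, Matrix.one_apply, smul_eq_mul,
    smul_eq_mul]
  split_ifs
  · rw [mul_one, mul_one]
  · rw [mul_zero, mul_zero, map_zero]

end RingHomMap

section Pencil

variable {n k m : ℕ} {e : Fin k ⊕ (Fin k ⊕ Fin k) ≃ Fin m} {Tp Np : AffMat n k} {sp : MvPolynomial (Fin n × Fin n) ℂ}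

/-- Evaluation at a point commutes with the graft construction. -/
theorem graft_map_eval (Tp Np : AffMat n k) (sp : MvPolynomial (Fin n × Fin n) ℂ) (x : Fin n × Fin n → ℂ) :
    (fromBlocks 0 (fromCols (sp • (1 : Matrix (Fin k) (Fin k) (MvPolynomial (Fin n × Fin n) ℂ))) (Tp + Np))
        (fromRows Tp (-(sp • (1 : Matrix (Fin k) (Fin k) (MvPolynomial (Fin n × Fin n) ℂ))))) 0).map (MvPolynomial.eval x)
      = fromBlocks 0 (fromCols ((MvPolynomial.eval x sp) • (1 : Matrix (Fin k) (Fin k) ℂ))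
          (Tp.map (MvPolynomial.eval x) + Np.map (MvPolynomial.eval x)))
        (fromRows (Tp.map (MvPolynomial.eval x)) (-((MvPolynomial.eval x sp) • (1 : Matrix (Fin k) (Fin k) ℂ)))) 0 := by
  rw [fromBlocks_map, fromCols_map, fromRows_map, Matrix.map_zero _ (map_zero _), Matrix.map_zero _ (map_zero _),
    Matrix.map_add _ (map_add _), Matrix.map_neg _ (map_neg _), smul_one_map_ringHom]

/-- Re-indexed matrices act on re-indexed vectors: `(reindex e e X) *ᵥ (w ∘ e.symm) = (X *ᵥ w) ∘ e.symm`. [folklore] -/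
theorem reindex_mulVec_comp {R : Type*} [CommRing R] {ι κ : Type*} [Fintype ι] [Fintype κ] (e' : ι ≃ κ)
    (X : Matrix ι ι R) (w : ι → R) :
    (Matrix.reindex e' e' X) *ᵥ (w ∘ e'.symm) = (X *ᵥ w) ∘ e'.symm := by
  rw [Matrix.reindex_apply, Matrix.submatrix_mulVec_equiv]
  have hw : (w ∘ ⇑e'.symm) ∘ ⇑e'.symm.symm = w := by
    funext i
    simp
  rw [hw]

/-- ★ **The pencil-level graft is `IrreducibleInv`** (the stub's hypothesis, by name) as soon as the pencil is FULL on the `(T, s)`-coordinates off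
the core: every `graft(T, 0, s)`, `T ∈ M_k(ℂ)`, `s ∈ ℂ`, is a value.  (Values transport along `e`; then ✓ `graft_irreducible` with `𝒩 = {0}`.) -/
theorem irreducibleInv_graft
    (hfull : ∀ (T : Matrix (Fin k) (Fin k) ℂ) (s : ℂ), ∃ x : Fin n × Fin n → ℂ,
      Tp.map (MvPolynomial.eval x) = T ∧ Np.map (MvPolynomial.eval x) = 0 ∧ MvPolynomial.eval x sp = s)
    (G : AffMat n m)
    (hG : G = Matrix.reindex e e (fromBlocks 0
      (fromCols (sp • (1 : Matrix (Fin k) (Fin k) (MvPolynomial (Fin n × Fin n) ℂ))) (Tp + Np))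
      (fromRows Tp (-(sp • (1 : Matrix (Fin k) (Fin k) (MvPolynomial (Fin n × Fin n) ℂ))))) 0)) :
    IrreducibleInv G := by
  intro V hV
  -- transport `V` to the layer index type
  let φ : (Fin k ⊕ (Fin k ⊕ Fin k) → ℂ) ≃ₗ[ℂ] (Fin m → ℂ) := LinearEquiv.funCongrLeft ℂ ℂ e.symm
  have hφ : ∀ w : Fin k ⊕ (Fin k ⊕ Fin k) → ℂ, (φ w : Fin m → ℂ) = w ∘ e.symm := fun w => rfl
  set W : Submodule ℂ (Fin k ⊕ (Fin k ⊕ Fin k) → ℂ) := V.comap (φ : (Fin k ⊕ (Fin k ⊕ Fin k) → ℂ) →ₗ[ℂ] (Fin m → ℂ))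
    with hWdef
  have hWinv : ∀ (T N : Matrix (Fin k) (Fin k) ℂ) (s : ℂ), N ∈ ({0} : Set (Matrix (Fin k) (Fin k) ℂ)) → ∀ w ∈ W,
      (fromBlocks 0 (fromCols (s • (1 : Matrix (Fin k) (Fin k) ℂ)) (T + N)) (fromRows T (-(s • (1 : Matrix (Fin k) (Fin k) ℂ)))) 0)
        *ᵥ w ∈ W := by
    intro T N s hN w hw
    rw [Set.mem_singleton_iff] at hN
    subst hN
    obtain ⟨x, hT, hN0, hs⟩ := hfull T s
    have h1 := hV x (φ w) hw
    rw [hG, Matrix.reindex_apply, ← Matrix.submatrix_map, graft_map_eval, hT, hN0, hs, ← Matrix.reindex_apply, hφ,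
      reindex_mulVec_comp] at h1
    show (φ _ : Fin m → ℂ) ∈ V
    rw [hφ]
    exact h1
  have hW := graft_irreducible ({0} : Set (Matrix (Fin k) (Fin k) ℂ)) (Set.mem_singleton _) W hWinv
  have hsurj : Function.Surjective (φ : (Fin k ⊕ (Fin k ⊕ Fin k) → ℂ) →ₗ[ℂ] (Fin m → ℂ)) := φ.surjective
  have hVW : V = W.map (φ : (Fin k ⊕ (Fin k ⊕ Fin k) → ℂ) →ₗ[ℂ] (Fin m → ℂ)) :=
    (Submodule.map_comap_eq_of_surjective hsurj V).symm
  rcases hW with h | h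
  · left
    rw [hVW, h, Submodule.map_bot]
  · right
    rw [hVW, h, Submodule.map_top, LinearMap.range_eq_top]
    exact hsurj

end Pencil

end Summit.ValiantsHypothesis.ValiantsHypothesis.Theorems.GrenetZeon.BipartiteGraft
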